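import Literature.NumberTheory.QuadraticFields.EuclideanQuadraticFieldFundamentalTheorem
import Literature.NumberTheory.QuadraticFields.GaussianPrimary
import Mathlib.NumberTheory.LegendreSymbol.QuadraticReciprocity
import Mathlib.NumberTheory.LegendreSymbol.JacobiSymbol
import Mathlib.RingTheory.PrincipalIdealDomain
import Mathlib.RingTheory.Prime
import Mathlib.Tactic.NormNum.LegendreSymbol
import HarnessLib

/-!
# The Hecke character `λ ↦ (λ/√−7)₂ · λ` of `ℤ[½(1+√−7)]` and its multiplicative sums
# `S(m) = ∑_{N λ = m, λ ≡ 1, 2, 4 (mod √−7)} λ`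

Topic `Literature/NumberTheory/QuadraticFields`, namespace `Literature.NumberTheory.QuadraticFields.OmegaNegSeven`.
The `√−7`-twin of `GaussianPrimary` (`ℤ[i]`), `SqrtNegTwoPrimary` (`ℤ[√-2]`) and `QuadraticOrderEisensteinNumbers` (`ℤ[ω]`),
filed for the Hecke-theta dictionary of the CM elliptic curves with `j = −3375` (`X₀(49)` and its quadratic twists
`y² = x(x² + 21Dx + 112D²)`, CM by `ℤ[½(1+√−7)]`; Rajwade 1977): Rajwade's Theorem 4
«`L_D(s) = ∑_{λ ≡ 1,2,4 (mod √−7)} (D/λ) λ̄ (Nλ)^{−s}`».  The carrier is Mathlib's `QuadraticAlgebra ℤ (−2) 1`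
(elements `⟨x, y⟩ = x + yω`, `ω = ½(1 + √−7)`, `ω² = ω − 2`, `N(x + yω) = x² + xy + 2y²`), for which the tree proves unique
factorisation (`EuclideanQuadraticFieldFundamentalTheorem.ufm_omega_neg_seven`, Hardy–Wright Thm. 246).  Everything here is
proved; two definitions (`chi`, the quadratic character modulo `√−7`, and the finite sets / sums `normEq`, `heckeNormEq`,
`heckeSum`) and no instance.

## Content

* `chi z = (z/√−7)₂ ∈ {0, ±1}` — the quadratic residue symbol modulo the ramified prime `√−7 = 2ω − 1`: `ℤ[ω]/(√−7) = 𝔽₇` with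
  `ω ↦ 4`, so `chi (x + yω) = ((x + 4y)/7) = ((2x + y)/7)` (Legendre symbols; `chi_mk`).  It is multiplicative, `chi (−1) = −1`,
  `chi z̄ = chi z`, and `chi z = 0 ↔ 7 ∣ N z`.  Rajwade's normalisation «`λ ≡ 1, 2 or 4 (mod √−7)`» (the subgroup of squares of
  `𝔽₇ˣ`) is `chi λ = 1`; every `z` with `7 ∤ N z` has EXACTLY ONE normalised associate `±z`, namely `nmz z := chi z · z`
  (`nmz_mul`, `nmz_star`, `nmz_eq_of_associated`; the units are `±1`, `eq_one_or_eq_neg_one_of_isUnit`).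
* `normEq m`, `heckeNormEq m = {λ : N λ = m, chi λ = 1}`, `heckeSum m = S(m) = ∑_{λ ∈ heckeNormEq m} λ`:
  `S(1) = 1`; `S(m) = 0` for `7 ∣ m`; **`S(mm') = S(m)S(m')` for coprime `m, m'`** (`heckeSum_mul_of_coprime`, from the
  bijection `(y, z) ↦ yz`, `sum_heckeNormEq_mul_of_coprime`, via Bézout in the principal ideal ring `ℤ[ω]`);
  `∑_{N z = m} chi z · g z = 2 ∑_{λ ∈ heckeNormEq m} g λ` for odd `g` (`sum_normEq_chi_mul_eq_two_mul`).
* inert primes `p ≡ 3, 5, 6 (mod 7)`: `p` is prime in `ℤ[ω]`, `chi p = −1`, the elements of norm `p^k` are `±p^{k/2}`, and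
  **`S(p^{2j}) = (−p)^j`, `S(p^{2j+1}) = 0`** (`heckeSum_pow_of_inert`);
* split primes `p ≡ 1, 2, 4 (mod 7)` (including `p = 2 = ω ω̄`): **there is a normalised `π` with `N π = p`**
  (`exists_chi_eq_one_norm_eq`), `π ∤ π̄`, the elements of norm `p^k` are `±π^j π̄^{k−j}`, and
  **`S(p^k) = ∑_{j ≤ k} π^j π̄^{k−j}`** (`heckeSum_pow_of_split`).

## References
* A. R. Rajwade, *The Diophantine equation `y² = x(x² + 21Dx + 112D²)` and the conjectures of Birch and Swinnerton-Dyer*,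
  J. Austral. Math. Soc. Ser. A 24 (1977), 286–295: Thm. 3 (`π ≡ 1, 2, 4 (mod √−7)`), Thm. 4 (the `L`-series). [Rajwade1977]
* A. Silverberg, *Group order formulas for reductions of CM elliptic curves*, Contemp. Math. 521 (2010), (2.1) and Table 1
  (`#A(7)(𝔽_p) = p + 1 − (4u/7)·2u`, `A(7) = 49a1`). [Silverberg2010]
* G. H. Hardy, E. M. Wright, *An Introduction to the Theory of Numbers*, 6th ed. (2008), Thm. 246 (`k(√−7)` is Euclidean).
  [HardyWright2008]
* K. Ireland, M. Rosen, *A Classical Introduction to Modern Number Theory*, 2nd ed. (1990), Ch. 9 §7, Ch. 18 §6 (the model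
  followed: primary elements and the multiplicative sums). [IrelandRosen1990]

## Mathlib / tree search
Tree: `EuclideanQuadraticFieldFundamentalTheorem.{norm_mk, isDomain_of_norm_eq_zero, norm_eq_zero_three, euclidean_of_criterion,
criterion_omega_of_criterion_three, isPrincipalIdealRing_of_euclidean, thm245, ufm_omega_neg_seven}`,
`EuclideanCriterion.criterion_three_of_round`, `GaussianPrimary.eq_of_dvd_of_mul_eq`, `SqrtNegTwoPrimary` (the `ℤ[√-2]` twin, same
architecture).  Mathlib: `QuadraticAlgebra.{norm, norm_def, star_mk, lift, mk_mul_mk, isUnit_iff_norm_isUnit}`, `IsBezout.gcd`,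
`quadraticChar`, `legendreSym`, `ZMod.isSquare_neg_one_iff`… (`lean search 'OmegaNegSeven|QuadraticAlgebra ℤ \(-2\) 1'`: only
`ufm_omega_neg_seven`).
-/

namespace Literature.NumberTheory.QuadraticFields

namespace OmegaNegSeven

open QuadraticAlgebra EuclideanQuadraticFieldFundamentalTheorem

/-! ### Norm, integrality, units and conjugation in `ℤ[ω]`, `ω = ½(1 + √−7)` -/

/-- `N(x + yω) = x² + xy + 2y²`. [cite: HardyWright2008, §14.3 Thm 238] -/
theorem norm_mk' (x y : ℤ) : (⟨x, y⟩ : QuadraticAlgebra ℤ (-2) 1).norm = x ^ 2 + x * y + 2 * y ^ 2 := by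
  rw [norm_mk]; ring

/-- `N z = re² + re·im + 2 im²`. [cite: HardyWright2008, §14.3 Thm 238] -/
theorem norm_eq' (z : QuadraticAlgebra ℤ (-2) 1) : z.norm = z.re ^ 2 + z.re * z.im + 2 * z.im ^ 2 := by
  rw [QuadraticAlgebra.norm_def]; ring

/-- `4 N(x + yω) = (2x + y)² + 7y²` — the norm form of `ℚ(√−7)` in the coordinates `x + yω = ½((2x + y) + y√−7)`.
[cite: HardyWright2008, §14.7 (14.7.3)] -/
theorem four_mul_norm (z : QuadraticAlgebra ℤ (-2) 1) : 4 * z.norm = (2 * z.re + z.im) ^ 2 + 7 * z.im ^ 2 := by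
  rw [QuadraticAlgebra.norm_def]; ring

/-- The norm is nonnegative. [cite: HardyWright2008, §14.7] -/
theorem norm_nonneg' (z : QuadraticAlgebra ℤ (-2) 1) : 0 ≤ z.norm := by
  nlinarith [four_mul_norm z, sq_nonneg (2 * z.re + z.im), sq_nonneg z.im]

/-- `−7 = 4·(−2) + 1` is square-free. [cite: HardyWright2008, §14.1] -/
theorem squarefree_neg_seven : Squarefree (4 * (-2 : ℤ) + 1) := by
  rw [show (4 * (-2 : ℤ) + 1) = -7 by norm_num]
  have h7 : Prime (7 : ℤ) := Int.prime_iff_natAbs_prime.mpr (by norm_num)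
  exact (Prime.neg h7).squarefree

/-- `N z = 0 ↔ z = 0` (the norm form is anisotropic). [cite: HardyWright2008, §14.4] -/
theorem norm_eq_zero_iff' (z : QuadraticAlgebra ℤ (-2) 1) : z.norm = 0 ↔ z = 0 :=
  ⟨norm_eq_zero_three squarefree_neg_seven (by norm_num) z, by rintro rfl; exact QuadraticAlgebra.norm_zero⟩

/-- `1 ≤ N z` for `z ≠ 0`. [cite: HardyWright2008, §14.4] -/
theorem one_le_norm {z : QuadraticAlgebra ℤ (-2) 1} (hz : z ≠ 0) : 1 ≤ z.norm := by
  have h0 := norm_nonneg' z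
  have h1 : z.norm ≠ 0 := fun h ↦ hz ((norm_eq_zero_iff' z).mp h)
  omega

/-- `ℤ[ω]` is an integral domain. [cite: HardyWright2008, §14.4] -/
theorem isDomain' : IsDomain (QuadraticAlgebra ℤ (-2) 1) :=
  isDomain_of_norm_eq_zero (norm_eq_zero_three squarefree_neg_seven (by norm_num))

/-- **`k(√−7)` is Euclidean** (property (E) of Hardy–Wright §14.7 for `ℤ[ω]`, Theorem 246). [cite: HardyWright2008, Thm 246] -/
theorem euclidean' : ∀ γ γ₁ : QuadraticAlgebra ℤ (-2) 1, γ₁ ≠ 0 →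
    ∃ κ γ₂ : QuadraticAlgebra ℤ (-2) 1, γ = κ * γ₁ + γ₂ ∧ γ₂.norm.natAbs < γ₁.norm.natAbs :=
  euclidean_of_criterion (norm_eq_zero_three squarefree_neg_seven (by norm_num))
    (criterion_omega_of_criterion_three (a := -2) (by
      intro r s
      obtain ⟨x, y, h⟩ := EuclideanCriterion.criterion_three_of_round (m := -7) (by norm_num) (by norm_num) r s
      exact ⟨x, y, by convert h using 2; push_cast; ring⟩))

/-- `ℤ[ω]` is a principal ideal ring (Euclid ⇒ PID). [cite: HardyWright2008, Thm 245] -/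
theorem isPrincipalIdealRing' : IsPrincipalIdealRing (QuadraticAlgebra ℤ (-2) 1) :=
  isPrincipalIdealRing_of_euclidean euclidean'

/-- `z ↦ z̄`: `conj (x + yω) = (x + y) − yω` (as `ω̄ = 1 − ω`). [cite: HardyWright2008, §14.3] -/
theorem star_mk' (x y : ℤ) : star (⟨x, y⟩ : QuadraticAlgebra ℤ (-2) 1) = ⟨x + y, -y⟩ := by
  rw [star_mk, one_mul]

/-- `star n = n` for an integer `n`. [cite: HardyWright2008, §14.3] -/
theorem star_intCast (n : ℤ) : star (n : QuadraticAlgebra ℤ (-2) 1) = n := by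
  ext <;> simp [re_intCast, im_intCast]

/-- `star p = p` for a natural number `p`. [cite: HardyWright2008, §14.3] -/
theorem star_natCast (n : ℕ) : star (n : QuadraticAlgebra ℤ (-2) 1) = n := by
  ext <;> simp [re_natCast, im_natCast]

/-- `z z̄ = N z` (cast into `ℤ[ω]`). [cite: HardyWright2008, §14.3] -/
theorem self_mul_star (z : QuadraticAlgebra ℤ (-2) 1) : z * star z = ((z.norm : ℤ) : QuadraticAlgebra ℤ (-2) 1) := by
  ext <;> simp [QuadraticAlgebra.norm_def, re_intCast, im_intCast] <;> ring

/-- `z ∣ N z` in `ℤ[ω]`. [cite: HardyWright2008, §14.3] -/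
theorem self_dvd_norm (z : QuadraticAlgebra ℤ (-2) 1) : z ∣ ((z.norm : ℤ) : QuadraticAlgebra ℤ (-2) 1) :=
  ⟨star z, (self_mul_star z).symm⟩

/-- `N(z^k) = (N z)^k`. [cite: HardyWright2008, §14.4 (the norm is multiplicative)] -/
theorem norm_pow' (z : QuadraticAlgebra ℤ (-2) 1) (k : ℕ) : (z ^ k).norm = z.norm ^ k := map_pow QuadraticAlgebra.norm z k

/-- `a ∣ b → N a ∣ N b`. [cite: HardyWright2008, §14.4 (the norm is multiplicative)] -/
theorem norm_dvd_norm {a b : QuadraticAlgebra ℤ (-2) 1} (h : a ∣ b) : a.norm ∣ b.norm := by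
  obtain ⟨c, rfl⟩ := h
  exact ⟨c.norm, map_mul QuadraticAlgebra.norm a c⟩

/-- `p ∣ z̄ → p ∣ z` for a natural number `p`. [cite: HardyWright2008, §14.3] -/
theorem natCast_dvd_of_dvd_star {p : ℕ} {z : QuadraticAlgebra ℤ (-2) 1} (h : (p : QuadraticAlgebra ℤ (-2) 1) ∣ star z) :
    (p : QuadraticAlgebra ℤ (-2) 1) ∣ z := by
  obtain ⟨c, hc⟩ := h
  refine ⟨star c, ?_⟩
  have := congrArg star hc
  rwa [star_star, star_mul, star_natCast, mul_comm] at this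

/-- Coprime naturals are coprime in `ℤ[ω]`. [cite: HardyWright2008, Thm 245] -/
theorem isCoprime_natCast {m m' : ℕ} (h : m.Coprime m') :
    IsCoprime (m : QuadraticAlgebra ℤ (-2) 1) (m' : QuadraticAlgebra ℤ (-2) 1) := by
  have := (Nat.isCoprime_iff_coprime.mpr h).map (Int.castRingHom (QuadraticAlgebra ℤ (-2) 1))
  simpa using this

/-- `z` is a unit iff `N z = 1`. [cite: HardyWright2008, §14.4] -/
theorem isUnit_iff_norm_eq_one (z : QuadraticAlgebra ℤ (-2) 1) : IsUnit z ↔ z.norm = 1 := by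
  rw [isUnit_iff_norm_isUnit, Int.isUnit_iff]
  have := norm_nonneg' z
  constructor
  · rintro (h | h)
    · exact h
    · omega
  · exact fun h ↦ Or.inl h

/-- **The units of `ℤ[ω]` are `±1`** («`k(√−7)` has only the two units `±1`»): `N(x + yω) = 1` forces `y = 0`, `x = ±1`.
[cite: Rajwade1977, §0 (p. 287)] -/
theorem eq_one_or_eq_neg_one_of_isUnit {u : QuadraticAlgebra ℤ (-2) 1} (hu : IsUnit u) : u = 1 ∨ u = -1 := by
  have h := (isUnit_iff_norm_eq_one u).mp hu
  obtain ⟨x, y⟩ := u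
  rw [norm_mk'] at h
  have hy2 : y ^ 2 < 1 := by nlinarith [sq_nonneg (2 * x + y)]
  have hy : y = 0 := Int.abs_lt_one_iff.mp ((sq_lt_one_iff_abs_lt_one y).mp hy2)
  subst hy
  have hx : x ^ 2 = 1 := by linarith
  rcases sq_eq_one_iff.mp hx with rfl | rfl
  · left; rfl
  · right; ext <;> simp

/-! ### The quadratic character `chi = (·/√−7)₂` modulo the ramified prime -/

/-- **The quadratic residue symbol `chi z = (z/√−7)₂`** modulo the prime `√−7 = 2ω − 1` of `ℤ[ω]` (`ℤ[ω]/(√−7) = 𝔽₇`,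
`x + yω = ½((2x + y) + y√−7) ↦ ½(2x + y)`, and `½` is a square mod `7`): `chi (x + yω) = ((2x + y)/7)`, the Jacobi (= Legendre)
symbol.  It is `+1` exactly on Rajwade's classes «`1, 2, 4 (mod √−7)`», `−1` on `3, 5, 6`, `0` on `(√−7)`; the Grössencharacter of
`X₀(49)` is `(λ) ↦ chi λ · λ̄` (Rajwade's Thm. 4). [cite: Rajwade1977, Thm 3 and Thm 4] -/
def chi (z : QuadraticAlgebra ℤ (-2) 1) : ℤ := jacobiSym (2 * z.re + z.im) 7

/-- `chi (x + yω) = ((2x + y)/7)`. [cite: Rajwade1977, Thm 3] -/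
theorem chi_mk (x y : ℤ) : chi ⟨x, y⟩ = jacobiSym (2 * x + y) 7 := rfl

/-- The Jacobi symbol modulo `7` only depends on the residue mod `7`. [cite: IrelandRosen1990, Ch. 5 §2, Prop. 5.2.2] -/
theorem jacobiSym_seven_eq_of_emod_eq {a b : ℤ} (h : a % 7 = b % 7) : jacobiSym a 7 = jacobiSym b 7 :=
  jacobiSym.mod_left' (by exact_mod_cast h)

/-- `(a/7) = 0 ↔ 7 ∣ a`. [cite: IrelandRosen1990, Ch. 5 §2, Prop. 5.2.2] -/
theorem jacobiSym_seven_eq_zero_iff (a : ℤ) : jacobiSym a 7 = 0 ↔ (7 : ℤ) ∣ a := by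
  rw [jacobiSym.mod_left, Int.dvd_iff_emod_eq_zero]
  have h0 : 0 ≤ a % 7 := Int.emod_nonneg a (by norm_num)
  have h1 : a % 7 < 7 := Int.emod_lt_of_pos a (by norm_num)
  push_cast
  interval_cases a % 7 <;> norm_num

/-- **`chi` is multiplicative**: with `ℓ(x + yω) = 2x + y` one has `ℓ(zw) = 4 ℓ(z) ℓ(w) − 7(2x₁x₂ + x₁y₂ + x₂y₁ + y₁y₂)` and
`(4/7) = 1`. [cite: Rajwade1977, Thm 4] -/
theorem chi_mul (z w : QuadraticAlgebra ℤ (-2) 1) : chi (z * w) = chi z * chi w := by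
  obtain ⟨x₁, y₁⟩ := z
  obtain ⟨x₂, y₂⟩ := w
  rw [mk_mul_mk, chi_mk, chi_mk, chi_mk, ← jacobiSym.mul_left]
  have h : (2 * (x₁ * x₂ + -2 * y₁ * y₂) + (x₁ * y₂ + y₁ * x₂ + 1 * y₁ * y₂)) % 7 =
      (4 * ((2 * x₁ + y₁) * (2 * x₂ + y₂))) % 7 := by
    have e : 2 * (x₁ * x₂ + -2 * y₁ * y₂) + (x₁ * y₂ + y₁ * x₂ + 1 * y₁ * y₂) =
        4 * ((2 * x₁ + y₁) * (2 * x₂ + y₂)) + 7 * (-(2 * x₁ * x₂ + x₁ * y₂ + x₂ * y₁ + y₁ * y₂)) := by ring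
    rw [e, Int.add_mul_emod_self_left]
  rw [jacobiSym_seven_eq_of_emod_eq h, jacobiSym.mul_left]
  norm_num

/-- `chi 1 = 1`. [cite: Rajwade1977, Thm 3] -/
@[simp] theorem chi_one : chi 1 = 1 := by
  rw [chi]; norm_num

/-- `chi (z^k) = (chi z)^k`. [cite: Rajwade1977, Thm 4] -/
theorem chi_pow (z : QuadraticAlgebra ℤ (-2) 1) (k : ℕ) : chi (z ^ k) = chi z ^ k := by
  induction k with
  | zero => simp
  | succ k ih => rw [pow_succ, chi_mul, ih, pow_succ]

/-- `chi z` in terms of the coordinates of `z`. [cite: Rajwade1977, Thm 3] -/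
theorem chi_eq (z : QuadraticAlgebra ℤ (-2) 1) : chi z = jacobiSym (2 * z.re + z.im) 7 := rfl

/-- `chi z ∈ {0, 1, −1}`. [cite: Rajwade1977, Thm 3] -/
theorem chi_trichotomy (z : QuadraticAlgebra ℤ (-2) 1) : chi z = 0 ∨ chi z = 1 ∨ chi z = -1 :=
  jacobiSym.trichotomy _ _

/-- `chi n = (n/7)` for an integer `n` (as `(2/7) = 1`). [cite: Rajwade1977, Thm 3] -/
theorem chi_intCast (n : ℤ) : chi (n : QuadraticAlgebra ℤ (-2) 1) = jacobiSym n 7 := by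
  rw [chi_eq, re_intCast, im_intCast, add_zero, jacobiSym.mul_left]
  norm_num

/-- `chi p = (p/7)` for a natural number `p`. [cite: Rajwade1977, Thm 3] -/
theorem chi_natCast (n : ℕ) : chi (n : QuadraticAlgebra ℤ (-2) 1) = jacobiSym n 7 := by
  rw [← Int.cast_natCast, chi_intCast]

/-- `chi (−1) = −1` (`−1` is a non-residue mod `7`): the units `±1` are separated by `chi`. [cite: Rajwade1977, Thm 3] -/
@[simp] theorem chi_neg_one : chi (-1 : QuadraticAlgebra ℤ (-2) 1) = -1 := by
  rw [show (-1 : QuadraticAlgebra ℤ (-2) 1) = ((-1 : ℤ) : QuadraticAlgebra ℤ (-2) 1) by push_cast; rfl, chi_intCast]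
  norm_num

/-- `chi (−z) = −chi z`. [cite: Rajwade1977, Thm 3] -/
theorem chi_neg (z : QuadraticAlgebra ℤ (-2) 1) : chi (-z) = -chi z := by
  rw [← neg_one_mul, chi_mul, chi_neg_one, neg_one_mul]

/-- `chi z̄ = chi z` (complex conjugation is trivial on `ℤ[ω]/(√−7)`). [cite: Rajwade1977, Thm 3] -/
theorem chi_star (z : QuadraticAlgebra ℤ (-2) 1) : chi (star z) = chi z := by
  obtain ⟨x, y⟩ := z
  rw [star_mk', chi_mk, chi_mk]
  congr 1
  ring

/-- `chi z = 0 ↔ 7 ∣ 2 re z + im z`. [cite: Rajwade1977, Thm 3] -/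
theorem chi_eq_zero_iff (z : QuadraticAlgebra ℤ (-2) 1) : chi z = 0 ↔ (7 : ℤ) ∣ 2 * z.re + z.im := by
  rw [chi_eq, jacobiSym_seven_eq_zero_iff]

/-- `7 ∣ n ↔ n ≡ 0` in `ℤ/7`. [cite: IrelandRosen1990, Ch. 3 §2] -/
theorem seven_dvd_iff (n : ℤ) : (7 : ℤ) ∣ n ↔ (n : ZMod 7) = 0 :=
  (ZMod.intCast_zmod_eq_zero_iff_dvd n 7).symm

/-- `7 ∣ N z ↔ 7 ∣ 2 re z + im z` (`4 N z = (2 re z + im z)² + 7 im²`). [cite: Rajwade1977, §2] -/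
theorem seven_dvd_norm_iff (z : QuadraticAlgebra ℤ (-2) 1) : (7 : ℤ) ∣ z.norm ↔ (7 : ℤ) ∣ 2 * z.re + z.im := by
  have h4 := four_mul_norm z
  have key : ∀ N l y : ZMod 7, 4 * N = l ^ 2 + 7 * y ^ 2 → (N = 0 ↔ l = 0) := by decide
  have h4' : (4 : ZMod 7) * (z.norm : ZMod 7) = ((2 * z.re + z.im : ℤ) : ZMod 7) ^ 2 + 7 * (z.im : ZMod 7) ^ 2 := by
    have := congrArg (Int.cast : ℤ → ZMod 7) h4
    push_cast at this ⊢
    exact this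
  rw [seven_dvd_iff, seven_dvd_iff]
  exact key _ _ _ h4'

/-- **`chi z = 0 ↔ 7 ∣ N z`** (`z ∈ (√−7)` iff its norm is divisible by `7`). [cite: Rajwade1977, §2] -/
theorem chi_eq_zero_iff_dvd_norm (z : QuadraticAlgebra ℤ (-2) 1) : chi z = 0 ↔ (7 : ℤ) ∣ z.norm := by
  rw [chi_eq_zero_iff, seven_dvd_norm_iff]

/-- `chi z = ±1` when `7 ∤ N z`. [cite: Rajwade1977, Thm 3] -/
theorem chi_eq_one_or_of_not_dvd {z : QuadraticAlgebra ℤ (-2) 1} (h : ¬ (7 : ℤ) ∣ z.norm) : chi z = 1 ∨ chi z = -1 := by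
  rcases chi_trichotomy z with h0 | h1
  · exact absurd ((chi_eq_zero_iff_dvd_norm z).mp h0) h
  · exact h1

/-- `chi z ≠ 0 → 7 ∤ N z`. [cite: Rajwade1977, Thm 3] -/
theorem not_dvd_norm_of_chi_ne_zero {z : QuadraticAlgebra ℤ (-2) 1} (h : chi z ≠ 0) : ¬ (7 : ℤ) ∣ z.norm :=
  fun h7 ↦ h ((chi_eq_zero_iff_dvd_norm z).mpr h7)

/-- `chi z = 1 → z ≠ 0`. [cite: Rajwade1977, Thm 3] -/
theorem ne_zero_of_chi_eq_one {z : QuadraticAlgebra ℤ (-2) 1} (h : chi z = 1) : z ≠ 0 := by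
  rintro rfl
  rw [chi_eq, re_zero, im_zero] at h
  norm_num at h

/-- `chi u · u = 1` for a unit `u = ±1`. [cite: Rajwade1977, Thm 3] -/
theorem chi_mul_self_of_isUnit {u : QuadraticAlgebra ℤ (-2) 1} (hu : IsUnit u) :
    (chi u : QuadraticAlgebra ℤ (-2) 1) * u = 1 := by
  rcases eq_one_or_eq_neg_one_of_isUnit hu with rfl | rfl
  · rw [chi_one]; push_cast; ring
  · rw [chi_neg_one]; push_cast; ring

/-! ### Rajwade's normalisation: `nmz z = chi z · z`, the associate `≡ 1, 2, 4 (mod √−7)` -/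

/-- **The normalised associate `nmz z = chi z · z`**: for `7 ∤ N z` this is the unique element of `{z, −z}` with `chi = 1`
(Rajwade: «the factors `π, π̄` are normalized so that `π, π̄ ≡ 1, 2 or 4 (mod √−7)`»); for `z ∈ (√−7)` it is `0`.
It is the value at the ideal `(z)` of the Hecke character of `X₀(49)`. [cite: Rajwade1977, Thm 3 and Thm 4] -/
def nmz (z : QuadraticAlgebra ℤ (-2) 1) : QuadraticAlgebra ℤ (-2) 1 := (chi z : QuadraticAlgebra ℤ (-2) 1) * z

/-- `nmz` is multiplicative. [cite: Rajwade1977, Thm 4] -/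
theorem nmz_mul (z w : QuadraticAlgebra ℤ (-2) 1) : nmz (z * w) = nmz z * nmz w := by
  simp only [nmz, chi_mul]; push_cast; ring

/-- `nmz 1 = 1`. [cite: Rajwade1977, Thm 4] -/
@[simp] theorem nmz_one : nmz 1 = 1 := by simp [nmz]

/-- `nmz (z^k) = (nmz z)^k`. [cite: Rajwade1977, Thm 4] -/
theorem nmz_pow (z : QuadraticAlgebra ℤ (-2) 1) (k : ℕ) : nmz (z ^ k) = nmz z ^ k := by
  induction k with
  | zero => simp
  | succ k ih => rw [pow_succ, nmz_mul, ih, pow_succ]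

/-- `nmz z = z` when `chi z = 1`. [cite: Rajwade1977, Thm 3] -/
theorem nmz_of_chi_eq_one {z : QuadraticAlgebra ℤ (-2) 1} (h : chi z = 1) : nmz z = z := by
  rw [nmz, h]; push_cast; ring

/-- `nmz (−z) = nmz z`. [cite: Rajwade1977, Thm 3] -/
theorem nmz_neg (z : QuadraticAlgebra ℤ (-2) 1) : nmz (-z) = nmz z := by
  rw [nmz, nmz, chi_neg]; push_cast; ring

/-- `nmz u = 1` for a unit. [cite: Rajwade1977, Thm 3] -/
theorem nmz_of_isUnit {u : QuadraticAlgebra ℤ (-2) 1} (hu : IsUnit u) : nmz u = 1 := chi_mul_self_of_isUnit hu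

/-- `nmz z̄ = conj (nmz z)`. [cite: Rajwade1977, Thm 4] -/
theorem nmz_star (z : QuadraticAlgebra ℤ (-2) 1) : nmz (star z) = star (nmz z) := by
  rw [nmz, nmz, chi_star, star_mul, star_intCast, mul_comm]

/-- Associated elements have the same normalisation. [cite: Rajwade1977, Thm 3] -/
theorem nmz_eq_of_associated {z w : QuadraticAlgebra ℤ (-2) 1} (h : Associated z w) : nmz z = nmz w := by
  obtain ⟨u, rfl⟩ := h
  rw [nmz_mul, nmz_of_isUnit u.isUnit, mul_one]

/-- `chi (nmz z) = (chi z)²`. [cite: Rajwade1977, Thm 3] -/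
theorem chi_nmz (z : QuadraticAlgebra ℤ (-2) 1) : chi (nmz z) = chi z ^ 2 := by
  rw [nmz, chi_mul, chi_intCast]
  rcases chi_trichotomy z with h | h | h <;> rw [h] <;> norm_num

/-- `chi (nmz z) = 1` when `7 ∤ N z` — the normalised associate is normalised. [cite: Rajwade1977, Thm 3] -/
theorem chi_nmz_eq_one {z : QuadraticAlgebra ℤ (-2) 1} (h : chi z ≠ 0) : chi (nmz z) = 1 := by
  rw [chi_nmz]
  rcases chi_trichotomy z with h0 | h1 | h1
  · exact absurd h0 h
  · rw [h1]; norm_num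
  · rw [h1]; norm_num

/-- `N (nmz z) = N z` when `7 ∤ N z`. [cite: Rajwade1977, Thm 3] -/
theorem norm_nmz {z : QuadraticAlgebra ℤ (-2) 1} (h : chi z ≠ 0) : norm (nmz z) = norm z := by
  rcases chi_trichotomy z with h0 | h1 | h1
  · exact absurd h0 h
  · rw [nmz_of_chi_eq_one h1]
  · rw [nmz, h1]; push_cast; rw [neg_one_mul, QuadraticAlgebra.norm_neg]

/-- `nmz z` is associated to `z` when `7 ∤ N z`. [cite: Rajwade1977, Thm 3] -/
theorem associated_nmz {z : QuadraticAlgebra ℤ (-2) 1} (h : chi z ≠ 0) : Associated z (nmz z) := by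
  rcases chi_trichotomy z with h0 | h1 | h1
  · exact absurd h0 h
  · rw [nmz_of_chi_eq_one h1]
  · refine ⟨-1, ?_⟩
    rw [nmz, h1, Units.val_neg, Units.val_one]; push_cast; ring

/-- **Uniqueness of the normalised associate**: normalised associated elements are equal. [cite: Rajwade1977, Thm 3] -/
theorem eq_of_associated_of_chi_eq_one {z w : QuadraticAlgebra ℤ (-2) 1} (hz : chi z = 1) (hw : chi w = 1)
    (h : Associated z w) : z = w := by
  rw [← nmz_of_chi_eq_one hz, ← nmz_of_chi_eq_one hw, nmz_eq_of_associated h]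

/-! ### The sets of (normalised) elements of given norm and the sums `S(m)` -/

/-- The (finite) set of elements of `ℤ[ω]` of norm `m`. [cite: Rajwade1977, Thm 4] -/
noncomputable def normEq (m : ℕ) : Finset (QuadraticAlgebra ℤ (-2) 1) :=
  (((Finset.Icc (-(2 * m : ℤ)) (2 * m)) ×ˢ (Finset.Icc (-(2 * m : ℤ)) (2 * m))).image
    fun p : ℤ × ℤ ↦ (⟨p.1, p.2⟩ : QuadraticAlgebra ℤ (-2) 1)).filter fun z ↦ z.norm = m

/-- `z ∈ normEq m ↔ N z = m` (the coordinates of an element of norm `m` are bounded by `2m`: `7 re² ≤ 8 N`, `7 im² ≤ 4 N`).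
[cite: Rajwade1977, Thm 4] -/
theorem mem_normEq {m : ℕ} {z : QuadraticAlgebra ℤ (-2) 1} : z ∈ normEq m ↔ z.norm = m := by
  simp only [normEq, Finset.mem_filter, Finset.mem_image, Finset.mem_product, Finset.mem_Icc, Prod.exists,
    and_iff_right_iff_imp]
  intro h
  refine ⟨z.re, z.im, ⟨?_, ?_⟩, rfl⟩
  · have h1 : (z.re.natAbs : ℤ) ≤ 2 * m := by
      have h4 := four_mul_norm z
      rw [h] at h4
      nlinarith [Int.natAbs_le_self_sq z.re, sq_nonneg (z.re + 4 * z.im), sq_nonneg z.im]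
    constructor <;> omega
  · have h1 : (z.im.natAbs : ℤ) ≤ 2 * m := by
      have h4 := four_mul_norm z
      rw [h] at h4
      nlinarith [Int.natAbs_le_self_sq z.im, sq_nonneg (2 * z.re + z.im)]
    constructor <;> omega

/-- The (finite) set of NORMALISED elements (`chi = 1`, Rajwade's `λ ≡ 1, 2, 4 (mod √−7)`) of norm `m` — one per ideal of norm
`m` prime to `√−7`. [cite: Rajwade1977, Thm 4] -/
noncomputable def heckeNormEq (m : ℕ) : Finset (QuadraticAlgebra ℤ (-2) 1) := (normEq m).filter fun z ↦ chi z = 1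

/-- `z ∈ heckeNormEq m ↔ N z = m ∧ chi z = 1`. [cite: Rajwade1977, Thm 4] -/
theorem mem_heckeNormEq {m : ℕ} {z : QuadraticAlgebra ℤ (-2) 1} : z ∈ heckeNormEq m ↔ z.norm = m ∧ chi z = 1 := by
  rw [heckeNormEq, Finset.mem_filter, mem_normEq]

/-- **`S(m) = ∑_{N λ = m, λ ≡ 1,2,4 (mod √−7)} λ`**, the `m`-th coefficient of Rajwade's Hecke series
`L_1(s) = ∑_λ λ̄ (Nλ)^{−s}` of `ℚ(√−7)` attached to `X₀(49)` (the set is conjugation-stable, so `∑ λ = ∑ λ̄`).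
[cite: Rajwade1977, Thm 4] -/
noncomputable def heckeSum (m : ℕ) : QuadraticAlgebra ℤ (-2) 1 := ∑ z ∈ heckeNormEq m, z

/-- The normalised elements of norm `1`: only `1`. [cite: Rajwade1977, Thm 4] -/
theorem heckeNormEq_one : heckeNormEq 1 = {1} := by
  ext z
  rw [mem_heckeNormEq, Finset.mem_singleton, Nat.cast_one]
  constructor
  · rintro ⟨hn, hc⟩
    rcases eq_one_or_eq_neg_one_of_isUnit ((isUnit_iff_norm_eq_one z).mpr hn) with rfl | rfl
    · rfl
    · rw [chi_neg_one] at hc; norm_num at hc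
  · rintro rfl
    exact ⟨QuadraticAlgebra.norm_one, chi_one⟩

/-- `S(1) = 1`. [cite: Rajwade1977, Thm 4] -/
@[simp] theorem heckeSum_one : heckeSum 1 = 1 := by
  rw [heckeSum, heckeNormEq_one, Finset.sum_singleton]

/-- No normalised element has norm divisible by `7`. [cite: Rajwade1977, Thm 4] -/
theorem heckeNormEq_eq_empty_of_seven_dvd {m : ℕ} (hm : 7 ∣ m) : heckeNormEq m = ∅ := by
  ext z
  simp only [mem_heckeNormEq, Finset.notMem_empty, iff_false, not_and]
  intro hz hc
  have h7 : (7 : ℤ) ∣ z.norm := by rw [hz]; exact_mod_cast hm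
  rw [(chi_eq_zero_iff_dvd_norm z).mpr h7] at hc
  exact zero_ne_one hc

/-- `S(m) = 0` for `7 ∣ m` (the Euler factor at the ramified prime is `1`). [cite: Rajwade1977, Thm 4] -/
theorem heckeSum_of_seven_dvd {m : ℕ} (hm : 7 ∣ m) : heckeSum m = 0 := by
  rw [heckeSum, heckeNormEq_eq_empty_of_seven_dvd hm, Finset.sum_empty]

/-- **`∑_{N z = m} chi z · g z = 2 ∑_{λ normalised, N λ = m} g λ` for an odd weight `g`**: the elements of norm `m` with
`chi = −1` are the negatives of the normalised ones, those with `chi = 0` do not contribute.  (Used to pass from the theta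
series over the whole lattice `ℤ[ω]` to Rajwade's sum over `λ ≡ 1, 2, 4 (mod √−7)`.) [cite: Rajwade1977, Thm 4] -/
theorem sum_normEq_chi_mul_eq_two_mul {M : Type*} [AddCommGroup M] (g : QuadraticAlgebra ℤ (-2) 1 → M)
    (hg : ∀ z, g (-z) = -g z) (m : ℕ) :
    ∑ z ∈ normEq m, (chi z) • g z = (2 : ℤ) • ∑ z ∈ heckeNormEq m, g z := by
  classical
  -- split `normEq m` according to the value of `chi`
  have hsplit : ∑ z ∈ normEq m, (chi z) • g z =
      ∑ z ∈ (normEq m).filter (fun z ↦ chi z = 1), (chi z) • g z +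
        ∑ z ∈ (normEq m).filter (fun z ↦ chi z = -1), (chi z) • g z := by
    rw [← Finset.sum_filter_add_sum_filter_not (normEq m) (fun z ↦ chi z = 1)]
    congr 1
    rw [← Finset.sum_filter_add_sum_filter_not ((normEq m).filter fun z ↦ ¬ chi z = 1) (fun z ↦ chi z = -1),
      Finset.filter_filter, Finset.filter_filter]
    have h0 : ∑ z ∈ (normEq m).filter (fun z ↦ ¬ chi z = 1 ∧ ¬ chi z = -1), (chi z) • g z = 0 := by
      refine Finset.sum_eq_zero fun z hz ↦ ?_
      rw [Finset.mem_filter] at hz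
      rcases chi_trichotomy z with h | h | h
      · rw [h, zero_zsmul]
      · exact absurd h hz.2.1
      · exact absurd h hz.2.2
    rw [h0, add_zero]
    congr 1
    ext z
    simp only [Finset.mem_filter, and_congr_right_iff]
    intro _
    constructor
    · exact fun h ↦ h.2
    · intro h; exact ⟨by rw [h]; norm_num, h⟩
  rw [hsplit]
  -- the `chi = 1` part
  have h1 : ∑ z ∈ (normEq m).filter (fun z ↦ chi z = 1), (chi z) • g z = ∑ z ∈ heckeNormEq m, g z := by
    rw [heckeNormEq]
    refine Finset.sum_congr rfl fun z hz ↦ ?_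
    rw [(Finset.mem_filter.mp hz).2, one_zsmul]
  -- the `chi = −1` part, via `z ↦ −z`
  have h2 : ∑ z ∈ (normEq m).filter (fun z ↦ chi z = -1), (chi z) • g z = ∑ z ∈ heckeNormEq m, g z := by
    rw [heckeNormEq]
    refine Finset.sum_bij' (fun z _ ↦ -z) (fun z _ ↦ -z) ?_ ?_ (fun z _ ↦ neg_neg z) (fun z _ ↦ neg_neg z) ?_
    · intro z hz
      rw [Finset.mem_filter, mem_normEq] at hz ⊢
      exact ⟨by rw [QuadraticAlgebra.norm_neg]; exact hz.1, by rw [chi_neg, hz.2, neg_neg]⟩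
    · intro z hz
      rw [Finset.mem_filter, mem_normEq] at hz ⊢
      exact ⟨by rw [QuadraticAlgebra.norm_neg]; exact hz.1, by rw [chi_neg, hz.2]⟩
    · intro z hz
      rw [(Finset.mem_filter.mp hz).2, hg, neg_one_zsmul]
  rw [h1, h2, two_zsmul]

/-- `z + z̄ = 2 re z + im z` (an integer): the trace. [cite: HardyWright2008, §14.3] -/
theorem self_add_star (z : QuadraticAlgebra ℤ (-2) 1) :
    z + star z = ((2 * z.re + z.im : ℤ) : QuadraticAlgebra ℤ (-2) 1) := by
  ext
  · simp only [re_add, re_star, re_intCast, Int.cast_id]; ring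
  · simp only [im_add, im_star, im_intCast]; ring

/-! ### Multiplicativity: the bijection `(y, z) ↦ yz` for coprime norms -/

/-- `a ∣ m`, `b ∣ m'`, `ab = mm'` (`m, m' ≠ 0`) force `a = m`, `b = m'`. [folklore] -/
private theorem eq_of_dvd_of_mul_eq' {a b m m' : ℕ} (ha : a ∣ m) (hb : b ∣ m') (hab : a * b = m * m')
    (hm : m ≠ 0) (hm' : m' ≠ 0) : a = m ∧ b = m' :=
  GaussianPrimary.eq_of_dvd_of_mul_eq ha hb hab hm hm'

/-- **Weighted multiplicativity of the sums over normalised elements**: for coprime `m, m'`, `(y, z) ↦ yz` is a bijection from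
pairs of normalised elements of norms `m`, `m'` onto the normalised elements of norm `mm'` (unique factorisation in the
Euclidean domain `ℤ[ω]`: the inverse is `x ↦ (gcd(x, m), gcd(x, m'))`, normalised), so `∑_{N x = mm'} f(x) = ∑_{N y = m, N z = m'} f(yz)`
for every weight `f`. [cite: IrelandRosen1990, Ch. 18 §6, proof of Theorem 7 (analogue)] [cite: Rajwade1977, Thm 4] -/
theorem sum_heckeNormEq_mul_of_coprime {M : Type*} [AddCommMonoid M] (f : QuadraticAlgebra ℤ (-2) 1 → M) {m m' : ℕ}
    (h : m.Coprime m') :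
    ∑ x ∈ heckeNormEq (m * m'), f x = ∑ p ∈ heckeNormEq m ×ˢ heckeNormEq m', f (p.1 * p.2) := by
  classical
  haveI := isDomain'
  haveI := isPrincipalIdealRing'
  symm
  have hcop : IsCoprime (m : QuadraticAlgebra ℤ (-2) 1) (m' : QuadraticAlgebra ℤ (-2) 1) := isCoprime_natCast h
  have hdvd : ∀ {y : QuadraticAlgebra ℤ (-2) 1} {k : ℕ}, y.norm = k → y ∣ (k : QuadraticAlgebra ℤ (-2) 1) :=
    fun {y k} hy ↦ by
      have := self_dvd_norm y
      rwa [hy, Int.cast_natCast] at this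
  refine Finset.sum_bij (fun p _ ↦ p.1 * p.2) ?_ ?_ ?_ (fun _ _ ↦ rfl)
  · -- maps into
    rintro ⟨y, z⟩ hp
    rw [Finset.mem_product] at hp
    obtain ⟨hy, hyc⟩ := mem_heckeNormEq.mp hp.1
    obtain ⟨hz, hzc⟩ := mem_heckeNormEq.mp hp.2
    refine mem_heckeNormEq.mpr ⟨?_, by rw [chi_mul, hyc, hzc, one_mul]⟩
    rw [map_mul QuadraticAlgebra.norm, hy, hz, Nat.cast_mul]
  · -- injective
    rintro ⟨y, z⟩ hp ⟨y', z'⟩ hp' hyz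
    simp only at hyz
    rw [Finset.mem_product] at hp hp'
    obtain ⟨hy, hyc⟩ := mem_heckeNormEq.mp hp.1
    obtain ⟨hz', -⟩ := mem_heckeNormEq.mp hp'.2
    obtain ⟨hy', hyc'⟩ := mem_heckeNormEq.mp hp'.1
    have hc : IsCoprime y z' :=
      (hcop.of_isCoprime_of_dvd_left (hdvd hy)).of_isCoprime_of_dvd_right (hdvd hz')
    have h1 : y ∣ y' := hc.dvd_of_dvd_mul_right ⟨z, hyz.symm⟩
    obtain ⟨w, hw⟩ := h1
    have hm0 : (m : ℤ) ≠ 0 := by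
      rw [← hy]
      exact fun h0 ↦ ne_zero_of_chi_eq_one hyc ((norm_eq_zero_iff' y).mp h0)
    have hwn : w.norm = 1 := by
      have := congrArg QuadraticAlgebra.norm hw
      rw [map_mul QuadraticAlgebra.norm, hy, hy'] at this
      exact (mul_right_inj' hm0).mp (by rw [← this, mul_one])
    have hwu : IsUnit w := (isUnit_iff_norm_eq_one w).mpr hwn
    have hyy' : y = y' := eq_of_associated_of_chi_eq_one hyc hyc' ⟨hwu.unit, by rw [IsUnit.unit_spec, hw]⟩
    subst hyy'
    have hzz' : z = z' := mul_left_cancel₀ (ne_zero_of_chi_eq_one hyc) hyz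
    subst hzz'
    rfl
  · -- surjective
    intro x hx
    obtain ⟨hxn, hxc⟩ := mem_heckeNormEq.mp hx
    have hx0 : x ≠ 0 := ne_zero_of_chi_eq_one hxc
    have hm0 : m ≠ 0 := by
      rintro rfl
      rw [zero_mul, Nat.cast_zero, norm_eq_zero_iff'] at hxn
      exact hx0 hxn
    have hm0' : m' ≠ 0 := by
      rintro rfl
      rw [mul_zero, Nat.cast_zero, norm_eq_zero_iff'] at hxn
      exact hx0 hxn
    set g := IsBezout.gcd x (m : QuadraticAlgebra ℤ (-2) 1) with hg
    set g' := IsBezout.gcd x (m' : QuadraticAlgebra ℤ (-2) 1) with hg'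
    have hgx : g ∣ x := IsBezout.gcd_dvd_left _ _
    have hgm : g ∣ (m : QuadraticAlgebra ℤ (-2) 1) := IsBezout.gcd_dvd_right _ _
    have hg'x : g' ∣ x := IsBezout.gcd_dvd_left _ _
    have hg'm : g' ∣ (m' : QuadraticAlgebra ℤ (-2) 1) := IsBezout.gcd_dvd_right _ _
    have hcg : IsCoprime g g' := (hcop.of_isCoprime_of_dvd_left hgm).of_isCoprime_of_dvd_right hg'm
    have h1 : g * g' ∣ x := hcg.mul_dvd hgx hg'x
    have hxmm : x ∣ (m : QuadraticAlgebra ℤ (-2) 1) * m' := by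
      have := hdvd hxn
      rwa [Nat.cast_mul] at this
    have h2 : x ∣ g * g' := by
      obtain ⟨a, b, hab⟩ := IsBezout.gcd_eq_sum x (m : QuadraticAlgebra ℤ (-2) 1)
      obtain ⟨a', b', hab'⟩ := IsBezout.gcd_eq_sum x (m' : QuadraticAlgebra ℤ (-2) 1)
      rw [hg, hg', ← hab, ← hab']
      have : (a * x + b * (m : QuadraticAlgebra ℤ (-2) 1)) * (a' * x + b' * (m' : QuadraticAlgebra ℤ (-2) 1)) =
          x * (a * (a' * x + b' * (m' : QuadraticAlgebra ℤ (-2) 1)) + b * (m : QuadraticAlgebra ℤ (-2) 1) * a') +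
            (m : QuadraticAlgebra ℤ (-2) 1) * m' * (b * b') := by
        ring
      rw [this]
      exact dvd_add (dvd_mul_right _ _) (hxmm.mul_right _)
    have hassoc : Associated x (g * g') := associated_of_dvd_dvd h2 h1
    -- `chi g, chi g' ≠ 0`
    have hx7 : ¬ (7 : ℤ) ∣ x.norm := not_dvd_norm_of_chi_ne_zero (by rw [hxc]; exact one_ne_zero)
    have hg7 : chi g ≠ 0 := fun h0 ↦ hx7 (((chi_eq_zero_iff_dvd_norm g).mp h0).trans (norm_dvd_norm hgx))
    have hg'7 : chi g' ≠ 0 := fun h0 ↦ hx7 (((chi_eq_zero_iff_dvd_norm g').mp h0).trans (norm_dvd_norm hg'x))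
    -- norms
    have hng : g.norm.natAbs ∣ m := by
      have h3 : g.norm.natAbs ∣ m * m := by
        have := norm_dvd_norm hgm
        rw [QuadraticAlgebra.norm_natCast, sq] at this
        exact Int.natAbs_dvd_natAbs.mpr this |>.trans (by simp [Int.natAbs_mul])
      have h4 : g.norm.natAbs ∣ m * m' := by
        have := norm_dvd_norm hgx
        rw [hxn] at this
        have := Int.natAbs_dvd_natAbs.mpr this
        rwa [Int.natAbs_natCast] at this
      have h5 := Nat.dvd_gcd h3 h4
      rwa [Nat.gcd_mul_left, h.gcd_eq_one, mul_one] at h5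
    have hng' : g'.norm.natAbs ∣ m' := by
      have h3 : g'.norm.natAbs ∣ m' * m' := by
        have := norm_dvd_norm hg'm
        rw [QuadraticAlgebra.norm_natCast, sq] at this
        exact Int.natAbs_dvd_natAbs.mpr this |>.trans (by simp [Int.natAbs_mul])
      have h4 : g'.norm.natAbs ∣ m * m' := by
        have := norm_dvd_norm hg'x
        rw [hxn] at this
        have := Int.natAbs_dvd_natAbs.mpr this
        rwa [Int.natAbs_natCast] at this
      have h5 := Nat.dvd_gcd h4 h3
      rwa [Nat.gcd_mul_right, h.gcd_eq_one, one_mul] at h5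
    have hN : g.norm.natAbs * g'.norm.natAbs = m * m' := by
      obtain ⟨u, hu⟩ := hassoc
      have := congrArg QuadraticAlgebra.norm hu
      rw [map_mul QuadraticAlgebra.norm, map_mul QuadraticAlgebra.norm, (isUnit_iff_norm_eq_one _).mp u.isUnit,
        mul_one, hxn] at this
      have := congrArg Int.natAbs this
      rwa [Int.natAbs_mul, Int.natAbs_natCast, eq_comm] at this
    obtain ⟨hgm_eq, hg'm_eq⟩ := eq_of_dvd_of_mul_eq' hng hng' hN hm0 hm0'
    refine ⟨(nmz g, nmz g'), ?_, ?_⟩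
    · rw [Finset.mem_product]
      refine ⟨mem_heckeNormEq.mpr ⟨?_, chi_nmz_eq_one hg7⟩, mem_heckeNormEq.mpr ⟨?_, chi_nmz_eq_one hg'7⟩⟩
      · rw [norm_nmz hg7, ← hgm_eq, Int.natAbs_of_nonneg (norm_nonneg' g)]
      · rw [norm_nmz hg'7, ← hg'm_eq, Int.natAbs_of_nonneg (norm_nonneg' g')]
    · simp only
      rw [← nmz_mul, ← nmz_eq_of_associated hassoc, nmz_of_chi_eq_one hxc]

/-- **`S(m m') = S(m) S(m')` for coprime `m, m'`** — the Euler product of Rajwade's Hecke series.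
[cite: Rajwade1977, Thm 4] [cite: IrelandRosen1990, Ch. 18 §6, proof of Theorem 7 (analogue)] -/
theorem heckeSum_mul_of_coprime {m m' : ℕ} (h : m.Coprime m') :
    heckeSum (m * m') = heckeSum m * heckeSum m' := by
  rw [heckeSum, heckeSum, heckeSum, Finset.sum_mul_sum, ← Finset.sum_product']
  exact sum_heckeNormEq_mul_of_coprime (fun x ↦ x) h

/-! ### Inert primes `p ≡ 3, 5, 6 (mod 7)` -/

/-- An element of prime norm is prime in `ℤ[ω]`. [cite: HardyWright2008, Thm 245] -/
theorem prime_of_norm_eq_prime {π : QuadraticAlgebra ℤ (-2) 1} {p : ℕ} (hp : p.Prime) (h : π.norm = p) : Prime π := by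
  obtain ⟨hD, hU⟩ := ufm_omega_neg_seven
  have hirr : Irreducible π := by
    refine irreducible_iff.mpr ⟨fun hu ↦ ?_, fun a b hab ↦ ?_⟩
    · have := (isUnit_iff_norm_eq_one π).mp hu
      rw [h] at this
      exact hp.ne_one (by exact_mod_cast this)
    · have hn := congrArg QuadraticAlgebra.norm hab
      rw [map_mul QuadraticAlgebra.norm, h] at hn
      have hn' := congrArg Int.natAbs hn
      rw [Int.natAbs_natCast, Int.natAbs_mul] at hn'
      rcases Nat.prime_mul_iff.mp (hn' ▸ hp) with ⟨-, hb⟩ | ⟨-, ha⟩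
      · right
        rw [isUnit_iff_norm_eq_one, ← Int.natAbs_of_nonneg (norm_nonneg' b), hb, Nat.cast_one]
      · left
        rw [isUnit_iff_norm_eq_one, ← Int.natAbs_of_nonneg (norm_nonneg' a), ha, Nat.cast_one]
  exact hirr.prime

/-- **No element of `ℤ[ω]` has norm `p ≡ 3, 5, 6 (mod 7)`** (`4p = ℓ² + 7y²` would make `4p`, hence `p`, a square mod `7`).
[cite: Rajwade1977, Thm 3 («p is not a norm, i.e. p ≡ 3, 5, 13 (mod 14)»)] -/
theorem norm_ne_of_inert {p : ℕ} (hp7 : p % 7 = 3 ∨ p % 7 = 5 ∨ p % 7 = 6) (z : QuadraticAlgebra ℤ (-2) 1) :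
    z.norm ≠ p := by
  intro h
  have h4 := four_mul_norm z
  rw [h] at h4
  have hc : (4 : ZMod 7) * ((p % 7 : ℕ) : ZMod 7) = ((2 * z.re + z.im : ℤ) : ZMod 7) ^ 2 + 7 * (z.im : ZMod 7) ^ 2 := by
    rw [ZMod.natCast_mod]
    have := congrArg (Int.cast : ℤ → ZMod 7) h4
    push_cast at this ⊢
    exact this
  have key : ∀ l y : ZMod 7, (4 : ZMod 7) * 3 ≠ l ^ 2 + 7 * y ^ 2 ∧ (4 : ZMod 7) * 5 ≠ l ^ 2 + 7 * y ^ 2 ∧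
      (4 : ZMod 7) * 6 ≠ l ^ 2 + 7 * y ^ 2 := by decide
  obtain ⟨k3, k5, k6⟩ := key ((2 * z.re + z.im : ℤ) : ZMod 7) (z.im : ZMod 7)
  rcases hp7 with h7 | h7 | h7 <;> rw [h7] at hc
  · exact k3 (by exact_mod_cast hc)
  · exact k5 (by exact_mod_cast hc)
  · exact k6 (by exact_mod_cast hc)

/-- **A prime `p ≡ 3, 5, 6 (mod 7)` stays prime in `ℤ[ω]`** (`p` is not a norm). [cite: Rajwade1977, Thm 3] -/
theorem prime_natCast_of_inert {p : ℕ} (hp : p.Prime) (hp7 : p % 7 = 3 ∨ p % 7 = 5 ∨ p % 7 = 6) :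
    Prime (p : QuadraticAlgebra ℤ (-2) 1) := by
  obtain ⟨hD, hU⟩ := ufm_omega_neg_seven
  have hirr : Irreducible (p : QuadraticAlgebra ℤ (-2) 1) := by
    refine irreducible_iff.mpr ⟨fun hu ↦ ?_, fun a b hab ↦ ?_⟩
    · have h1 := (isUnit_iff_norm_eq_one _).mp hu
      rw [QuadraticAlgebra.norm_natCast] at h1
      have h2 : (2 : ℤ) ≤ p := by exact_mod_cast hp.two_le
      nlinarith
    · have hn := congrArg QuadraticAlgebra.norm hab
      rw [QuadraticAlgebra.norm_natCast, map_mul QuadraticAlgebra.norm] at hn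
      -- `N(a) N(b) = p²`: one of them is `1`, or both are `p`
      have ha0 := norm_nonneg' a
      have hb0 := norm_nonneg' b
      have hn' : a.norm.natAbs * b.norm.natAbs = p * p := by
        have := congrArg Int.natAbs hn
        rwa [Int.natAbs_mul, Int.natAbs_pow, Int.natAbs_natCast, eq_comm, sq] at this
      have hdvd : a.norm.natAbs ∣ p ^ 2 := by rw [sq]; exact Dvd.intro _ hn'
      obtain ⟨i, hi, hai⟩ := (Nat.dvd_prime_pow hp).mp hdvd
      interval_cases i
      · left
        rw [pow_zero] at hai
        rw [isUnit_iff_norm_eq_one, ← Int.natAbs_of_nonneg ha0, hai, Nat.cast_one]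
      · -- `N(a) = p`: impossible
        exfalso
        rw [pow_one] at hai
        exact norm_ne_of_inert hp7 a (by rw [← Int.natAbs_of_nonneg ha0, hai])
      · right
        rw [hai, sq] at hn'
        have hp0 : 0 < p * p := Nat.pos_of_ne_zero (mul_ne_zero hp.ne_zero hp.ne_zero)
        have hb1 : b.norm.natAbs = 1 := Nat.eq_of_mul_eq_mul_left hp0 (hn'.trans (mul_one _).symm)
        rw [isUnit_iff_norm_eq_one, ← Int.natAbs_of_nonneg hb0, hb1, Nat.cast_one]
  exact hirr.prime

/-- `chi p = (p/7) = −1` at an inert prime (`χ((p)) = −p`: the Hecke character at the inert primes). [cite: Rajwade1977, Thm 4] -/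
theorem chi_natCast_of_inert {p : ℕ} (hp7 : p % 7 = 3 ∨ p % 7 = 5 ∨ p % 7 = 6) :
    chi (p : QuadraticAlgebra ℤ (-2) 1) = -1 := by
  rw [chi_natCast, jacobiSym.mod_left, ← Int.natCast_mod]
  rcases hp7 with h | h | h <;> rw [h] <;> norm_num

/-- `nmz p = −p` at an inert prime. [cite: Rajwade1977, Thm 4] -/
theorem nmz_natCast_of_inert {p : ℕ} (hp7 : p % 7 = 3 ∨ p % 7 = 5 ∨ p % 7 = 6) :
    nmz (p : QuadraticAlgebra ℤ (-2) 1) = -(p : QuadraticAlgebra ℤ (-2) 1) := by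
  rw [nmz, chi_natCast_of_inert hp7]; push_cast; ring

/-- **Elements of norm `p^k` at an inert prime**: `k = 2j` and `x = ±p^j`. [cite: IrelandRosen1990, Ch. 18 §6 (analogue)] -/
theorem associated_pow_of_norm_eq_pow_of_inert {p : ℕ} (hp : p.Prime) (hp7 : p % 7 = 3 ∨ p % 7 = 5 ∨ p % 7 = 6)
    (k : ℕ) (x : QuadraticAlgebra ℤ (-2) 1) (hx : x.norm = (p : ℤ) ^ k) :
    ∃ j : ℕ, k = 2 * j ∧ Associated x ((p : QuadraticAlgebra ℤ (-2) 1) ^ j) := by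
  haveI := isDomain'
  induction k using Nat.strong_induction_on generalizing x with
  | _ k ih =>
    rcases k with _ | k
    · refine ⟨0, rfl, ?_⟩
      rw [pow_zero, associated_one_iff_isUnit, isUnit_iff_norm_eq_one, hx, pow_zero]
    · have hprime : Prime (p : QuadraticAlgebra ℤ (-2) 1) := prime_natCast_of_inert hp hp7
      have hdvd : (p : QuadraticAlgebra ℤ (-2) 1) ∣ x * star x := by
        rw [self_mul_star, hx]
        push_cast
        exact dvd_pow_self _ (Nat.succ_ne_zero k)
      have hpx : (p : QuadraticAlgebra ℤ (-2) 1) ∣ x := by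
        rcases hprime.dvd_or_dvd hdvd with h | h
        · exact h
        · exact natCast_dvd_of_dvd_star h
      obtain ⟨x', rfl⟩ := hpx
      rcases k with _ | k
      · exfalso
        rw [map_mul QuadraticAlgebra.norm, QuadraticAlgebra.norm_natCast, zero_add, pow_one] at hx
        have hx0 : x' ≠ 0 := by
          rintro rfl
          rw [QuadraticAlgebra.norm_zero, mul_zero] at hx
          exact hp.ne_zero (by exact_mod_cast hx.symm)
        have h1 : 1 ≤ x'.norm := one_le_norm hx0
        have hp2 : (2 : ℤ) ≤ p := by exact_mod_cast hp.two_le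
        nlinarith
      · have hx' : x'.norm = (p : ℤ) ^ k := by
          rw [map_mul QuadraticAlgebra.norm, QuadraticAlgebra.norm_natCast] at hx
          have hp0 : (p : ℤ) ≠ 0 := by exact_mod_cast hp.ne_zero
          apply mul_left_cancel₀ (pow_ne_zero 2 hp0)
          rw [hx]
          ring
        obtain ⟨j, hj, hassoc⟩ := ih k (by omega) x' hx'
        refine ⟨j + 1, by omega, ?_⟩
        rw [pow_succ, mul_comm ((p : QuadraticAlgebra ℤ (-2) 1) ^ j)]
        exact (Associated.refl _).mul_mul hassoc

/-- **Normalised elements of norm `p^{2j}`, `p^{2j+1}` at an inert prime**: `{(−p)^j}` and `∅`.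
[cite: Rajwade1977, Thm 4] [cite: IrelandRosen1990, Ch. 18 §6 (analogue)] -/
theorem heckeNormEq_pow_of_inert {p : ℕ} (hp : p.Prime) (hp7 : p % 7 = 3 ∨ p % 7 = 5 ∨ p % 7 = 6) (j : ℕ) :
    heckeNormEq (p ^ (2 * j)) = {(-(p : QuadraticAlgebra ℤ (-2) 1)) ^ j} ∧ heckeNormEq (p ^ (2 * j + 1)) = ∅ := by
  have hchi : chi (-(p : QuadraticAlgebra ℤ (-2) 1)) = 1 := by rw [chi_neg, chi_natCast_of_inert hp7, neg_neg]
  constructor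
  · refine Finset.eq_singleton_iff_unique_mem.mpr ⟨?_, fun x hx ↦ ?_⟩
    · refine mem_heckeNormEq.mpr ⟨?_, by rw [chi_pow, hchi, one_pow]⟩
      rw [norm_pow', QuadraticAlgebra.norm_neg, QuadraticAlgebra.norm_natCast]
      push_cast
      ring
    · obtain ⟨hxn, hxc⟩ := mem_heckeNormEq.mp hx
      obtain ⟨j', hj', hassoc⟩ := associated_pow_of_norm_eq_pow_of_inert hp hp7 (2 * j) x
        (by rw [hxn]; push_cast; ring)
      obtain rfl : j = j' := by omega
      rw [← nmz_of_chi_eq_one hxc, nmz_eq_of_associated hassoc, nmz_pow, nmz_natCast_of_inert hp7]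
  · ext x
    simp only [Finset.notMem_empty, iff_false]
    intro hx
    obtain ⟨hxn, -⟩ := mem_heckeNormEq.mp hx
    obtain ⟨j', hj', -⟩ := associated_pow_of_norm_eq_pow_of_inert hp hp7 (2 * j + 1) x
      (by rw [hxn]; push_cast; ring)
    omega

/-- **`S(p^{2j}) = (−p)^j` and `S(p^{2j+1}) = 0` for `p ≡ 3, 5, 6 (mod 7)`** (the Euler factor `(1 + p^{1−2s})⁻¹`: supersingular
primes of `X₀(49)`). [cite: Rajwade1977, Thm 3 and Thm 4] -/
theorem heckeSum_pow_of_inert {p : ℕ} (hp : p.Prime) (hp7 : p % 7 = 3 ∨ p % 7 = 5 ∨ p % 7 = 6) (j : ℕ) :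
    heckeSum (p ^ (2 * j)) = (-(p : QuadraticAlgebra ℤ (-2) 1)) ^ j ∧ heckeSum (p ^ (2 * j + 1)) = 0 := by
  obtain ⟨h1, h2⟩ := heckeNormEq_pow_of_inert hp hp7 j
  simp [heckeSum, h1, h2]

/-! ### Split primes `p ≡ 1, 2, 4 (mod 7)` -/

/-- **`π` and `π̄` are not associated** when `N(π) = p ≠ 7` is prime (`p` splits into two distinct primes of `ℤ[ω]`;
`π̄ = π` forces `p = re²`, `π̄ = −π` forces `p = 7 re²`). [cite: Rajwade1977, Thm 3] -/
theorem not_dvd_star_of_norm_eq_prime {π : QuadraticAlgebra ℤ (-2) 1} {p : ℕ} (hp : p.Prime) (hp7 : p ≠ 7)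
    (h : π.norm = p) : ¬ π ∣ star π := by
  rintro ⟨c, hc⟩
  have hp0 : (p : ℤ) ≠ 0 := by exact_mod_cast hp.ne_zero
  have hn := congrArg QuadraticAlgebra.norm hc
  rw [QuadraticAlgebra.norm_star, map_mul QuadraticAlgebra.norm, h] at hn
  have hc1 : c.norm = 1 := (mul_right_inj' hp0).mp (by rw [← hn, mul_one])
  have hcu : IsUnit c := (isUnit_iff_norm_eq_one c).mpr hc1
  obtain ⟨a, b⟩ := π
  have hpab : (p : ℤ) = a ^ 2 + a * b + 2 * b ^ 2 := by rw [← h, norm_mk']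
  have hre := congrArg QuadraticAlgebra.re hc
  have him := congrArg QuadraticAlgebra.im hc
  rcases eq_one_or_eq_neg_one_of_isUnit hcu with rfl | rfl <;>
    simp only [star_mk', mul_one, mul_neg, re_neg, im_neg] at hre him
  · -- `c = 1`: `b = 0`, `p = a²`
    have hb : b = 0 := by omega
    subst hb
    apply GaussianPrimary.not_prime_mul_self a.natAbs
    have : a.natAbs * a.natAbs = p := by
      zify
      rw [abs_mul_abs_self]
      linarith
    rw [this]
    exact hp
  · -- `c = −1`: `b = −2a`, `p = 7a²`
    have hb : b = -2 * a := by omega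
    subst hb
    have h7 : (7 : ℕ) ∣ p := by
      refine Int.natCast_dvd_natCast.mp ⟨a ^ 2, ?_⟩
      rw [hpab]; ring
    exact hp7 ((Nat.prime_dvd_prime_iff_eq (by norm_num) hp).mp h7).symm

/-- `p = π π̄` in `ℤ[ω]` when `N(π) = p`. [cite: Rajwade1977, Thm 3] -/
theorem natCast_eq_mul_star {π : QuadraticAlgebra ℤ (-2) 1} {p : ℕ} (h : π.norm = p) :
    (p : QuadraticAlgebra ℤ (-2) 1) = π * star π := by
  rw [self_mul_star, h, Int.cast_natCast]

/-- **Elements of norm `p^k` at a split prime**: `x = u π^j π̄^{k−j}` with `u` a unit (unique factorisation in `ℤ[ω]`).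
[cite: IrelandRosen1990, Ch. 18 §6 (analogue)] [cite: Rajwade1977, Thm 4] -/
theorem associated_pow_mul_pow_of_norm_eq_pow {π : QuadraticAlgebra ℤ (-2) 1} {p : ℕ} (hp : p.Prime) (h : π.norm = p)
    (k : ℕ) (x : QuadraticAlgebra ℤ (-2) 1) (hx : x.norm = (p : ℤ) ^ k) :
    ∃ j ≤ k, Associated x (π ^ j * star π ^ (k - j)) := by
  haveI := isDomain'
  have hprime := prime_of_norm_eq_prime hp h
  have hp0 : (p : ℤ) ≠ 0 := by exact_mod_cast hp.ne_zero
  induction k generalizing x with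
  | zero =>
    refine ⟨0, le_rfl, ?_⟩
    rw [pow_zero, Nat.sub_zero, pow_zero, mul_one, associated_one_iff_isUnit, isUnit_iff_norm_eq_one, hx, pow_zero]
  | succ k ih =>
    have hdvd : π ∣ x * star x := by
      rw [self_mul_star, hx]
      push_cast
      rw [natCast_eq_mul_star h]
      exact dvd_pow (dvd_mul_right π (star π)) (Nat.succ_ne_zero k)
    rcases hprime.dvd_or_dvd hdvd with hπx | hπx
    · obtain ⟨x', rfl⟩ := hπx
      have hx' : x'.norm = (p : ℤ) ^ k := by
        rw [map_mul QuadraticAlgebra.norm, h, pow_succ, mul_comm ((p : ℤ) ^ k)] at hx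
        exact mul_left_cancel₀ hp0 hx
      obtain ⟨j, hj, hassoc⟩ := ih x' hx'
      refine ⟨j + 1, by omega, ?_⟩
      rw [show k + 1 - (j + 1) = k - j by omega, pow_succ,
        show π ^ j * π * star π ^ (k - j) = π * (π ^ j * star π ^ (k - j)) by ring]
      exact (Associated.refl π).mul_mul hassoc
    · have hσx : star π ∣ x := by
        obtain ⟨c, hc⟩ := hπx
        refine ⟨star c, ?_⟩
        have := congrArg star hc
        rwa [star_star, star_mul, mul_comm] at this
      obtain ⟨x', rfl⟩ := hσx
      have hx' : x'.norm = (p : ℤ) ^ k := by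
        rw [map_mul QuadraticAlgebra.norm, QuadraticAlgebra.norm_star, h, pow_succ, mul_comm ((p : ℤ) ^ k)] at hx
        exact mul_left_cancel₀ hp0 hx
      obtain ⟨j, hj, hassoc⟩ := ih x' hx'
      refine ⟨j, by omega, ?_⟩
      rw [show k + 1 - j = (k - j) + 1 by omega, pow_succ,
        show π ^ j * (star π ^ (k - j) * star π) = star π * (π ^ j * star π ^ (k - j)) by ring]
      exact (Associated.refl (star π)).mul_mul hassoc

/-- `j ↦ π^j π̄^{k−j}` is injective on `0 ≤ j ≤ k` (as `π ∤ π̄`, `p ≠ 7`). [cite: Rajwade1977, Thm 4] -/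
theorem injOn_pow_mul_pow {π : QuadraticAlgebra ℤ (-2) 1} {p : ℕ} (hp : p.Prime) (hp7 : p ≠ 7) (h : π.norm = p)
    (k : ℕ) : Set.InjOn (fun j : ℕ ↦ π ^ j * star π ^ (k - j)) (Finset.range (k + 1) : Set ℕ) := by
  haveI := isDomain'
  have hprime := prime_of_norm_eq_prime hp h
  have hns := not_dvd_star_of_norm_eq_prime hp hp7 h
  have key : ∀ j₁ j₂ : ℕ, j₂ ≤ k → j₁ < j₂ → π ^ j₁ * star π ^ (k - j₁) ≠ π ^ j₂ * star π ^ (k - j₂) := by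
    intro j₁ j₂ hj₂ hlt heq
    rw [show j₂ = j₁ + (j₂ - j₁) by omega, pow_add, mul_assoc] at heq
    have heq' := mul_left_cancel₀ (pow_ne_zero _ hprime.ne_zero) heq
    have hdvd : π ∣ star π ^ (k - j₁) := by
      rw [heq']
      exact dvd_mul_of_dvd_left (dvd_pow_self π (by omega)) _
    exact hns (hprime.dvd_of_dvd_pow hdvd)
  intro j₁ hj₁ j₂ hj₂ heq
  simp only [Finset.coe_range, Set.mem_Iio] at hj₁ hj₂
  rcases lt_trichotomy j₁ j₂ with hlt | rfl | hgt
  · exact absurd heq (key j₁ j₂ (by omega) hlt)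
  · rfl
  · exact absurd heq.symm (key j₂ j₁ (by omega) hgt)

/-- **Normalised elements of norm `p^k` at a split prime `p = π π̄`**, `π` normalised: exactly the `π^j π̄^{k−j}`, `0 ≤ j ≤ k`.
[cite: Rajwade1977, Thm 4] [cite: IrelandRosen1990, Ch. 18 §6 (analogue)] -/
theorem heckeNormEq_pow_of_split {π : QuadraticAlgebra ℤ (-2) 1} {p : ℕ} (hp : p.Prime) (hπ : chi π = 1) (h : π.norm = p)
    (k : ℕ) : heckeNormEq (p ^ k) = (Finset.range (k + 1)).image fun j ↦ π ^ j * star π ^ (k - j) := by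
  have hchi : ∀ j i : ℕ, chi (π ^ j * star π ^ i) = 1 := fun j i ↦ by
    rw [chi_mul, chi_pow, chi_pow, chi_star, hπ, one_pow, one_pow, one_mul]
  ext x
  rw [mem_heckeNormEq, Finset.mem_image]
  constructor
  · rintro ⟨hxn, hxc⟩
    obtain ⟨j, hj, hassoc⟩ := associated_pow_mul_pow_of_norm_eq_pow hp h k x (by rw [hxn]; push_cast; ring)
    refine ⟨j, Finset.mem_range.mpr (by omega), ?_⟩
    rw [← nmz_of_chi_eq_one hxc, nmz_eq_of_associated hassoc, nmz_of_chi_eq_one (hchi j _)]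
  · rintro ⟨j, hj, rfl⟩
    refine ⟨?_, hchi j _⟩
    rw [Finset.mem_range] at hj
    rw [map_mul QuadraticAlgebra.norm, norm_pow', norm_pow', QuadraticAlgebra.norm_star, h, ← pow_add,
      show j + (k - j) = k by omega]
    push_cast
    ring

/-- **`S(p^k) = ∑_{j=0}^{k} π^j π̄^{k−j}` at a split prime** `p ≠ 7`, `p = N(π)`, `π` normalised (the Euler factor
`(1 − π̄ p^{−s})⁻¹(1 − π p^{−s})⁻¹`: ordinary primes of `X₀(49)`). [cite: Rajwade1977, Thm 3 and Thm 4] -/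
theorem heckeSum_pow_of_split {π : QuadraticAlgebra ℤ (-2) 1} {p : ℕ} (hp : p.Prime) (hp7 : p ≠ 7) (hπ : chi π = 1)
    (h : π.norm = p) (k : ℕ) :
    heckeSum (p ^ k) = ∑ j ∈ Finset.range (k + 1), π ^ j * star π ^ (k - j) := by
  rw [heckeSum, heckeNormEq_pow_of_split hp hπ h k, Finset.sum_image (injOn_pow_mul_pow hp hp7 h k)]

/-- The normalised elements of prime norm `p = N(π)` (`π` normalised, `p ≠ 7`) are `π` and `π̄`. [cite: Rajwade1977, Thm 3] -/
theorem eq_or_eq_star_of_norm_eq {π : QuadraticAlgebra ℤ (-2) 1} {p : ℕ} (hp : p.Prime) (hπ : chi π = 1) (h : π.norm = p)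
    {x : QuadraticAlgebra ℤ (-2) 1} (hx : chi x = 1) (hxn : x.norm = p) : x = π ∨ x = star π := by
  have hmem : x ∈ heckeNormEq (p ^ 1) := mem_heckeNormEq.mpr ⟨by rw [hxn, pow_one], hx⟩
  rw [heckeNormEq_pow_of_split hp hπ h 1, Finset.mem_image] at hmem
  obtain ⟨j, hj, hjx⟩ := hmem
  rw [Finset.mem_range] at hj
  interval_cases j
  · right; rw [← hjx]; simp
  · left; rw [← hjx]; simp

/-- `−7` is a square modulo an odd prime `p ≡ 1, 2, 4 (mod 7)` (quadratic reciprocity: `(−7/p) = (p/7)`).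
[cite: IrelandRosen1990, Ch. 5 §2 (reciprocity)] -/
theorem isSquare_neg_seven {p : ℕ} (hp : p.Prime) (hp2 : p ≠ 2) (hp7 : p % 7 = 1 ∨ p % 7 = 2 ∨ p % 7 = 4) :
    IsSquare ((-7 : ℤ) : ZMod p) := by
  haveI := Fact.mk hp
  haveI : Fact (Nat.Prime 7) := ⟨by norm_num⟩
  have hne7 : p ≠ 7 := by rintro rfl; norm_num at hp7
  have h7p : legendreSym 7 p = 1 := by
    rw [jacobiSym.legendreSym.to_jacobiSym, jacobiSym.mod_left, ← Int.natCast_mod]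
    rcases hp7 with h | h | h <;> rw [h] <;> norm_num
  have hodd : p % 4 = 1 ∨ p % 4 = 3 := by
    have := hp.eq_one_or_self_of_dvd 2
    omega
  have hval : legendreSym p (-7) = 1 := by
    rw [show (-7 : ℤ) = -1 * 7 by norm_num, legendreSym.mul, legendreSym.at_neg_one hp2]
    rcases hodd with h4 | h4
    · rw [ZMod.χ₄_nat_one_mod_four h4, one_mul]
      have := legendreSym.quadratic_reciprocity_one_mod_four (p := p) (q := 7) h4 (by norm_num)
      rw [h7p] at this
      exact_mod_cast this.symm
    · rw [ZMod.χ₄_nat_three_mod_four h4, neg_one_mul]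
      have := legendreSym.quadratic_reciprocity_three_mod_four (p := p) (q := 7) h4 (by norm_num)
      rw [h7p] at this
      have h' : legendreSym p 7 = -1 := by
        rw [show ((7 : ℕ) : ℤ) = 7 from rfl] at this
        omega
      rw [h', neg_neg]
  have hne : ((-7 : ℤ) : ZMod p) ≠ 0 := by
    rw [Ne, ZMod.intCast_zmod_eq_zero_iff_dvd]
    intro hd
    have : (p : ℤ) ∣ 7 := (dvd_neg.mp hd)
    have hp7' : p ∣ 7 := by exact_mod_cast this
    rcases (Nat.dvd_prime (by norm_num : Nat.Prime 7)).mp hp7' with h1 | h1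
    · exact hp.ne_one h1
    · exact hne7 h1
  exact (legendreSym.eq_one_iff p hne).mp hval

/-- **A prime `p ≡ 1, 2, 4 (mod 7)` is a norm from `ℤ[ω]`, `4p = u² + 7v²`, with NORMALISED `π`** (`chi π = 1`):
`p = 2 = N(ω)`; for odd `p`, `−7 ≡ c² (mod p)` so `p ∣ (c + √−7)(c − √−7)` divides neither factor, hence is not prime in the UFD
`ℤ[ω]`, hence `p = N(π)` for a proper divisor `π`; pass to the normalised associate.
[cite: Rajwade1977, Thm 3 («p = π π̄ … if p ≡ 1, 9, 11 (mod 14)»)] [cite: Silverberg2010, (2.1)] -/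
theorem exists_chi_eq_one_norm_eq {p : ℕ} (hp : p.Prime) (hp7 : p % 7 = 1 ∨ p % 7 = 2 ∨ p % 7 = 4) :
    ∃ π : QuadraticAlgebra ℤ (-2) 1, chi π = 1 ∧ π.norm = p := by
  have hne7 : p ≠ 7 := by rintro rfl; norm_num at hp7
  by_cases hp2 : p = 2
  · subst hp2
    exact ⟨⟨0, 1⟩, by rw [chi_mk]; norm_num, by rw [norm_mk']; norm_num⟩
  obtain ⟨hD, hU⟩ := ufm_omega_neg_seven
  -- `−7 ≡ c² (mod p)`
  obtain ⟨c0, hc0⟩ := isSquare_neg_seven hp hp2 hp7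
  obtain ⟨c, rfl⟩ := ZMod.intCast_surjective c0
  have hcp : (p : ℤ) ∣ c * c + 7 := by
    rw [← ZMod.intCast_zmod_eq_zero_iff_dvd]
    push_cast at hc0 ⊢
    rw [← hc0]; ring
  -- `p ∣ (c + √−7)(c − √−7)`, `√−7 = 2ω − 1`, but divides neither factor
  have hdvd : (p : QuadraticAlgebra ℤ (-2) 1) ∣ (⟨c - 1, 2⟩ : QuadraticAlgebra ℤ (-2) 1) * ⟨c + 1, -2⟩ := by
    obtain ⟨t, ht⟩ := hcp
    refine ⟨t, QuadraticAlgebra.ext ?_ ?_⟩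
    · simp only [re_mul, re_natCast, re_intCast, im_natCast, im_intCast]
      linear_combination ht
    · simp only [im_mul, re_natCast, im_natCast, re_intCast, im_intCast]
      ring
  have hndvd : ∀ (r s : ℤ), s = 2 ∨ s = -2 → ¬ (p : QuadraticAlgebra ℤ (-2) 1) ∣ (⟨r, s⟩ : QuadraticAlgebra ℤ (-2) 1) := by
    rintro r s hs ⟨t, ht⟩
    have := congrArg QuadraticAlgebra.im ht
    simp only [im_mul, re_natCast, im_natCast, zero_mul, add_zero, mul_zero] at this
    have h2 : (p : ℤ) ∣ 2 := by
      rcases hs with rfl | rfl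
      · exact ⟨t.im, this⟩
      · exact ⟨-t.im, by linarith⟩
    have : p ∣ 2 := by exact_mod_cast h2
    exact hp2 ((Nat.prime_dvd_prime_iff_eq hp Nat.prime_two).mp this)
  have hnotprime : ¬ Prime (p : QuadraticAlgebra ℤ (-2) 1) := fun hpr ↦ by
    rcases hpr.dvd_or_dvd hdvd with h | h
    · exact hndvd _ _ (Or.inl rfl) h
    · exact hndvd _ _ (Or.inr rfl) h
  have hnotirr : ¬ Irreducible (p : QuadraticAlgebra ℤ (-2) 1) := fun hirr ↦ hnotprime hirr.prime
  have hnu : ¬ IsUnit (p : QuadraticAlgebra ℤ (-2) 1) := by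
    intro hu
    have := (isUnit_iff_norm_eq_one _).mp hu
    rw [QuadraticAlgebra.norm_natCast] at this
    have h2 : (2 : ℤ) ≤ p := by exact_mod_cast hp.two_le
    nlinarith
  rw [irreducible_iff] at hnotirr
  simp only [not_and, not_forall, not_or] at hnotirr
  obtain ⟨a, b, hab, ha, hb⟩ := hnotirr hnu
  -- `N(a) N(b) = p²` with neither norm `1`: `N(a) = p`
  have hn := congrArg QuadraticAlgebra.norm hab
  rw [QuadraticAlgebra.norm_natCast, map_mul QuadraticAlgebra.norm] at hn
  have ha1 : a.norm ≠ 1 := fun h1 ↦ ha ((isUnit_iff_norm_eq_one a).mpr h1)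
  have hb1 : b.norm ≠ 1 := fun h1 ↦ hb ((isUnit_iff_norm_eq_one b).mpr h1)
  have ha0 := norm_nonneg' a
  have hb0 := norm_nonneg' b
  have hn' : a.norm.natAbs * b.norm.natAbs = p ^ 2 := by
    have := congrArg Int.natAbs hn
    rwa [Int.natAbs_mul, Int.natAbs_pow, Int.natAbs_natCast, eq_comm] at this
  have hdvda : a.norm.natAbs ∣ p ^ 2 := Dvd.intro _ hn'
  obtain ⟨i, hi, hai⟩ := (Nat.dvd_prime_pow hp).mp hdvda
  have hna : a.norm = p := by
    interval_cases i
    · exfalso; rw [pow_zero] at hai; exact ha1 (by rw [← Int.natAbs_of_nonneg ha0, hai]; rfl)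
    · rw [← Int.natAbs_of_nonneg ha0, hai, pow_one]
    · exfalso
      rw [hai] at hn'
      have hpp0 : 0 < p ^ 2 := Nat.pos_of_ne_zero (pow_ne_zero 2 hp.ne_zero)
      have : b.norm.natAbs = 1 := Nat.eq_of_mul_eq_mul_left hpp0 (hn'.trans (mul_one _).symm)
      exact hb1 (by rw [← Int.natAbs_of_nonneg hb0, this]; rfl)
  have hchi : chi a ≠ 0 := by
    intro h0
    have h7 := (chi_eq_zero_iff_dvd_norm a).mp h0
    rw [hna] at h7
    have : (7 : ℕ) ∣ p := by exact_mod_cast h7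
    exact hne7 ((Nat.prime_dvd_prime_iff_eq (by norm_num) hp).mp this).symm
  exact ⟨nmz a, chi_nmz_eq_one hchi, by rw [norm_nmz hchi, hna]⟩

/-- **`4p = u² + 7v²` with `u ≡ 1, 2, 4 (mod 7)`**, coordinate form of the previous theorem: `π = ½(u + v√−7)`, `u = 2 re π + im π`,
`v = im π`, `chi π = (u/7) = 1`, `π + π̄ = u`. [cite: Rajwade1977, Thm 3] [cite: Silverberg2010, (2.1)] -/
theorem exists_sq_add_seven_mul_sq {p : ℕ} (hp : p.Prime) (hp7 : p % 7 = 1 ∨ p % 7 = 2 ∨ p % 7 = 4) :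
    ∃ u v : ℤ, u ^ 2 + 7 * v ^ 2 = 4 * p ∧ jacobiSym u 7 = 1 := by
  obtain ⟨π, hπ, hn⟩ := exists_chi_eq_one_norm_eq hp hp7
  refine ⟨2 * π.re + π.im, π.im, ?_, hπ⟩
  rw [← hn, four_mul_norm]

end OmegaNegSeven

end Literature.NumberTheory.QuadraticFields
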